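import Summits.QuantumFields.YangMills.Theorems.UnitScaleTiltProp7LocMinOfJointRow
import HarnessLib

/-!
# Route `UnitScaleTilt`, crux K1 child «MinimiserStabilityRegPr» (stmt-QuantumFields-19200) — THE Lin-LEVEL SOCKET IN THE TWO (H1) LETTERS, WITH DIVERGENCE SLACK
# ((o1) of 2026-08-28: ★routeR-w3 g3's (116)-form `κ·M ≤ K + ¼·Dv` and ★p1 g13's (σ, Z)-budget form of ✓`Prop7HessWOfFibreCoreT3`)

Cell `ym3-torus`, width seat `ym-ust-19200-w4` (gen 4).  THEOREMS ONLY (0 `def`, 0 `sorry`).  YM₃ on T³ is a ladder rung (R3), not the Clay problem; nothing here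
claims the stub, the crux, d = 4 or the mass gap.

WHAT IS PROVED (ns `…Theorems.Prop7LocMinOfJointRowBudget`; a separate file because the door ✓`Prop7LocMinOfJointRow` sits at 378∕400 lines).
★★ `linRow_of_QRows_div` — HESS_W′ in print's (116)-form with the divergence summand displayed, `κ·Σ‖D‖² ≤ Σ_p‖ℒ_p(D)‖² + ¼·Dv` (`Dv` abstract; instantiate with
✓`hessW_curl_div_of_mem_fibre_T3`'s `Σ_xΣ_jk‖(D^*_W(iD))(x)_jk‖²`, `κ = (128·(18 + 537600L⁴))⁻¹ℓ⁻²`) ⟹ the Lin-level row with slack `Dv∕32`;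
★★ `linRow_of_QRows_budget` — HESS_W′ in the (σ, Z)-budget form of ✓`hessW_budget_of_fibre_T3` VERBATIM ⟹ the Lin-level row with slack `Z∕32` under the window
`64A′·(2ε₀C₁ℓ⁻² + 15552s² + 216·regThreshold(e)) ≤ ⅛ℓ⁻² − A′σ`; ★★ `wilsonAction4_le_expChart_of_linRow_slack` — Taylor only: a Lin-level row with slack `σ` gives
`A(W) ≤ A(e^{iD}W) + σ` (`σ = 0` on a Landau-gauged direction recovers ✓`wilsonAction4_le_expChart_of_linRow`).

HONEST SCOPE.  Pure bookkeeping; `--supports stmt-QuantumFields-19200`, count-neutral.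

References: T. Bałaban, CMP 102 (1985) 277–309 [Balaban1985Variational] ((116) p.295, (141)–(143) p.299, (6) p.278); CMP 99 (1985) 389–434 [Balaban1985BackgroundPropagators] (Thm 3.11 p.416).
-/

set_option autoImplicit false
noncomputable section

open scoped BigOperators Matrix.Norms.L2Operator Matrix Topology
open Filter

namespace Summit.QuantumFields.YangMills.Theorems.Prop7LocMinOfJointRowBudget

open Literature.MathematicalPhysics.QuantumFieldTheory.Balaban1983to89
open Literature.MathematicalPhysics.QuantumFieldTheory.Balaban1983to89.T3ContinuumYM3Torus
open Literature.MathematicalPhysics.QuantumFieldTheory.Balaban1983to89.T3UnitLawDensityEML (ℰp)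
open Literature.MathematicalPhysics.QuantumFieldTheory.Balaban1983to89.T3ConstrainedMinimiser
open Literature.MathematicalPhysics.QuantumFieldTheory.Balaban1983to89.T3Thm1Carrier
open Literature.MathematicalPhysics.QuantumFieldTheory.Balaban1983to89.T3PrintedRegularMinimiser
open Literature.MathematicalPhysics.QuantumFieldTheory.Balaban1983to89.T3RegularMinimiser
open Literature.MathematicalPhysics.QuantumFieldTheory.Balaban1983to89.T3SectALandauChart (emb15 pos_of_regPr)
open Summit.QuantumFields.YangMills.Theorems.Prop7TPrint (expHermField)
open Summit.QuantumFields.YangMills.Theorems.Prop7Taylor3Uniform (wilsonAction4_expChart_sub_lin_ge)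

variable (F : T3Family) {n K : ℕ}

/-! ## §5 The (116)-form twin: HESS_W′ with the divergence summand displayed (★routeR-w3 g3 2026-08-28 13:25Z, (H1) letter of
✓`Prop7HessWOfFibreCoreT3.hessW_curl_div_of_mem_fibre_T3`) -/

/-- ★★ **THE Lin-LEVEL ROW WITH DIVERGENCE SLACK.**  As `linRow_of_QRows`, but HESS_W′ in print's (116)-form `κ·Σ‖D‖² ≤ Σ_p‖ℒ_p(D)‖² + ¼·Dv` with the divergence
summand `Dv` displayed (an abstract real here; the supplier instantiates `Dv := Σ_xΣ_jk‖(D^*_W(iD))(x)_jk‖²` verbatim, `κ := (128·(18 + 537600L⁴))⁻¹·ℓ⁻²`): the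
Lin-level row then holds with slack `Dv∕32` (zero for a Landau-gauged direction). Pure bookkeeping. [cite: Balaban1985Variational, (116) p.295, (141)-(143) p.299] -/
theorem linRow_of_QRows_div {e s ε₀ R C₁ C₂ κ Dv : ℝ} (hε₀ : 0 ≤ ε₀) (W : GaugeField (F.P K) 0 (Matrix.specialUnitaryGroup (Fin 2) ℂ)) (D : PBond (F.P K) 0 → Matrix (Fin 2) (Fin 2) ℂ)
    (hELQ : |∑ p : Plaq (F.P K) 0, (1 / 2) * (((((GaugeField.plaqHol W p : Matrix.specialUnitaryGroup (Fin 2) ℂ) : Matrix (Fin 2) (Fin 2) ℂ) - 1)ᴴ * (((Complex.I • D ⟨p.src, p.μ⟩) + ((W ⟨p.src, p.μ⟩ : Matrix (Fin 2) (Fin 2) ℂ) * (Complex.I • D ⟨p.src.shift p.μ, p.ν⟩) * star (W ⟨p.src, p.μ⟩ : Matrix (Fin 2) (Fin 2) ℂ))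
            - (((W ⟨p.src, p.μ⟩ * W ⟨p.src.shift p.μ, p.ν⟩ * (W ⟨p.src.shift p.ν, p.μ⟩)⁻¹ : Matrix.specialUnitaryGroup (Fin 2) ℂ) : Matrix (Fin 2) (Fin 2) ℂ) * (Complex.I • D ⟨p.src.shift p.ν, p.μ⟩) * star ((W ⟨p.src, p.μ⟩ * W ⟨p.src.shift p.μ, p.ν⟩ * (W ⟨p.src.shift p.ν, p.μ⟩)⁻¹ : Matrix.specialUnitaryGroup (Fin 2) ℂ) : Matrix (Fin 2) (Fin 2) ℂ))
            - (((GaugeField.plaqHol W p : Matrix.specialUnitaryGroup (Fin 2) ℂ) : Matrix (Fin 2) (Fin 2) ℂ) * (Complex.I • D ⟨p.src, p.ν⟩) * star ((GaugeField.plaqHol W p : Matrix.specialUnitaryGroup (Fin 2) ℂ) : Matrix (Fin 2) (Fin 2) ℂ))) * ((GaugeField.plaqHol W p : Matrix.specialUnitaryGroup (Fin 2) ℂ) : Matrix (Fin 2) (Fin 2) ℂ))).trace).re| ≤ 2 * ε₀ * ((F.L : ℝ) ^ (K - n))⁻¹ * R)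
    (hR : R ≤ C₁ * ((F.L : ℝ) ^ (K - n))⁻¹ * ∑ b : PBond (F.P K) 0, ‖D b‖ ^ 2 + C₂ * (F.L : ℝ) ^ (K - n) * ∑ p : Plaq (F.P K) 0, ‖((Complex.I • D ⟨p.src, p.μ⟩) + ((W ⟨p.src, p.μ⟩ : Matrix (Fin 2) (Fin 2) ℂ) * (Complex.I • D ⟨p.src.shift p.μ, p.ν⟩) * star (W ⟨p.src, p.μ⟩ : Matrix (Fin 2) (Fin 2) ℂ))
            - (((W ⟨p.src, p.μ⟩ * W ⟨p.src.shift p.μ, p.ν⟩ * (W ⟨p.src.shift p.ν, p.μ⟩)⁻¹ : Matrix.specialUnitaryGroup (Fin 2) ℂ) : Matrix (Fin 2) (Fin 2) ℂ) * (Complex.I • D ⟨p.src.shift p.ν, p.μ⟩) * star ((W ⟨p.src, p.μ⟩ * W ⟨p.src.shift p.μ, p.ν⟩ * (W ⟨p.src.shift p.ν, p.μ⟩)⁻¹ : Matrix.specialUnitaryGroup (Fin 2) ℂ) : Matrix (Fin 2) (Fin 2) ℂ))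
            - (((GaugeField.plaqHol W p : Matrix.specialUnitaryGroup (Fin 2) ℂ) : Matrix (Fin 2) (Fin 2) ℂ) * (Complex.I • D ⟨p.src, p.ν⟩) * star ((GaugeField.plaqHol W p : Matrix.specialUnitaryGroup (Fin 2) ℂ) : Matrix (Fin 2) (Fin 2) ℂ)))‖ ^ 2)
    (hq' : κ * ∑ b : PBond (F.P K) 0, ‖D b‖ ^ 2 ≤ ∑ p : Plaq (F.P K) 0, ‖((Complex.I • D ⟨p.src, p.μ⟩) + ((W ⟨p.src, p.μ⟩ : Matrix (Fin 2) (Fin 2) ℂ) * (Complex.I • D ⟨p.src.shift p.μ, p.ν⟩) * star (W ⟨p.src, p.μ⟩ : Matrix (Fin 2) (Fin 2) ℂ))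
            - (((W ⟨p.src, p.μ⟩ * W ⟨p.src.shift p.μ, p.ν⟩ * (W ⟨p.src.shift p.ν, p.μ⟩)⁻¹ : Matrix.specialUnitaryGroup (Fin 2) ℂ) : Matrix (Fin 2) (Fin 2) ℂ) * (Complex.I • D ⟨p.src.shift p.ν, p.μ⟩) * star ((W ⟨p.src, p.μ⟩ * W ⟨p.src.shift p.μ, p.ν⟩ * (W ⟨p.src.shift p.ν, p.μ⟩)⁻¹ : Matrix.specialUnitaryGroup (Fin 2) ℂ) : Matrix (Fin 2) (Fin 2) ℂ))
            - (((GaugeField.plaqHol W p : Matrix.specialUnitaryGroup (Fin 2) ℂ) : Matrix (Fin 2) (Fin 2) ℂ) * (Complex.I • D ⟨p.src, p.ν⟩) * star ((GaugeField.plaqHol W p : Matrix.specialUnitaryGroup (Fin 2) ℂ) : Matrix (Fin 2) (Fin 2) ℂ)))‖ ^ 2 + 1 / 4 * Dv)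
    (hw₁ : 2 * ε₀ * C₂ ≤ 1 / 8)
    (hw₂ : 2 * ε₀ * C₁ * (((F.L : ℝ) ^ (K - n)) ^ 2)⁻¹ + 15552 * s ^ 2 + 216 * regThreshold F n K e ≤ κ / 8) :
    |∑ p : Plaq (F.P K) 0, (1 / 2) * (((((GaugeField.plaqHol W p : Matrix.specialUnitaryGroup (Fin 2) ℂ) : Matrix (Fin 2) (Fin 2) ℂ) - 1)ᴴ * (((Complex.I • D ⟨p.src, p.μ⟩) + ((W ⟨p.src, p.μ⟩ : Matrix (Fin 2) (Fin 2) ℂ) * (Complex.I • D ⟨p.src.shift p.μ, p.ν⟩) * star (W ⟨p.src, p.μ⟩ : Matrix (Fin 2) (Fin 2) ℂ))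
            - (((W ⟨p.src, p.μ⟩ * W ⟨p.src.shift p.μ, p.ν⟩ * (W ⟨p.src.shift p.ν, p.μ⟩)⁻¹ : Matrix.specialUnitaryGroup (Fin 2) ℂ) : Matrix (Fin 2) (Fin 2) ℂ) * (Complex.I • D ⟨p.src.shift p.ν, p.μ⟩) * star ((W ⟨p.src, p.μ⟩ * W ⟨p.src.shift p.μ, p.ν⟩ * (W ⟨p.src.shift p.ν, p.μ⟩)⁻¹ : Matrix.specialUnitaryGroup (Fin 2) ℂ) : Matrix (Fin 2) (Fin 2) ℂ))
            - (((GaugeField.plaqHol W p : Matrix.specialUnitaryGroup (Fin 2) ℂ) : Matrix (Fin 2) (Fin 2) ℂ) * (Complex.I • D ⟨p.src, p.ν⟩) * star ((GaugeField.plaqHol W p : Matrix.specialUnitaryGroup (Fin 2) ℂ) : Matrix (Fin 2) (Fin 2) ℂ))) * ((GaugeField.plaqHol W p : Matrix.specialUnitaryGroup (Fin 2) ℂ) : Matrix (Fin 2) (Fin 2) ℂ))).trace).re|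
        + (15552 * s ^ 2 + 216 * regThreshold F n K e) * ∑ b : PBond (F.P K) 0, ‖D b‖ ^ 2
      ≤ 1 / 4 * ∑ p : Plaq (F.P K) 0, ‖((Complex.I • D ⟨p.src, p.μ⟩) + ((W ⟨p.src, p.μ⟩ : Matrix (Fin 2) (Fin 2) ℂ) * (Complex.I • D ⟨p.src.shift p.μ, p.ν⟩) * star (W ⟨p.src, p.μ⟩ : Matrix (Fin 2) (Fin 2) ℂ))
            - (((W ⟨p.src, p.μ⟩ * W ⟨p.src.shift p.μ, p.ν⟩ * (W ⟨p.src.shift p.ν, p.μ⟩)⁻¹ : Matrix.specialUnitaryGroup (Fin 2) ℂ) : Matrix (Fin 2) (Fin 2) ℂ) * (Complex.I • D ⟨p.src.shift p.ν, p.μ⟩) * star ((W ⟨p.src, p.μ⟩ * W ⟨p.src.shift p.μ, p.ν⟩ * (W ⟨p.src.shift p.ν, p.μ⟩)⁻¹ : Matrix.specialUnitaryGroup (Fin 2) ℂ) : Matrix (Fin 2) (Fin 2) ℂ))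
            - (((GaugeField.plaqHol W p : Matrix.specialUnitaryGroup (Fin 2) ℂ) : Matrix (Fin 2) (Fin 2) ℂ) * (Complex.I • D ⟨p.src, p.ν⟩) * star ((GaugeField.plaqHol W p : Matrix.specialUnitaryGroup (Fin 2) ℂ) : Matrix (Fin 2) (Fin 2) ℂ)))‖ ^ 2 + 1 / 32 * Dv := by
  have hL1 : (1 : ℝ) ≤ (F.L : ℝ) := by have := F.hL.2; exact_mod_cast (by omega : 1 ≤ F.L)
  set ℓ : ℝ := (F.L : ℝ) ^ (K - n) with hℓ
  have hℓ1 : 1 ≤ ℓ := one_le_pow₀ hL1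
  have hℓ0 : 0 < ℓ := by linarith
  set M : ℝ := ∑ b : PBond (F.P K) 0, ‖D b‖ ^ 2 with hM
  set Kc : ℝ := ∑ p : Plaq (F.P K) 0, ‖((Complex.I • D ⟨p.src, p.μ⟩) + ((W ⟨p.src, p.μ⟩ : Matrix (Fin 2) (Fin 2) ℂ) * (Complex.I • D ⟨p.src.shift p.μ, p.ν⟩) * star (W ⟨p.src, p.μ⟩ : Matrix (Fin 2) (Fin 2) ℂ))
            - (((W ⟨p.src, p.μ⟩ * W ⟨p.src.shift p.μ, p.ν⟩ * (W ⟨p.src.shift p.ν, p.μ⟩)⁻¹ : Matrix.specialUnitaryGroup (Fin 2) ℂ) : Matrix (Fin 2) (Fin 2) ℂ) * (Complex.I • D ⟨p.src.shift p.ν, p.μ⟩) * star ((W ⟨p.src, p.μ⟩ * W ⟨p.src.shift p.μ, p.ν⟩ * (W ⟨p.src.shift p.ν, p.μ⟩)⁻¹ : Matrix.specialUnitaryGroup (Fin 2) ℂ) : Matrix (Fin 2) (Fin 2) ℂ))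
            - (((GaugeField.plaqHol W p : Matrix.specialUnitaryGroup (Fin 2) ℂ) : Matrix (Fin 2) (Fin 2) ℂ) * (Complex.I • D ⟨p.src, p.ν⟩) * star ((GaugeField.plaqHol W p : Matrix.specialUnitaryGroup (Fin 2) ℂ) : Matrix (Fin 2) (Fin 2) ℂ)))‖ ^ 2 with hKc
  have hM0 : 0 ≤ M := Finset.sum_nonneg fun _ _ => sq_nonneg _
  have hK0 : 0 ≤ Kc := Finset.sum_nonneg fun _ _ => sq_nonneg _
  have hco : 0 ≤ 2 * ε₀ * ℓ⁻¹ := by positivity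
  have h1 : |∑ p : Plaq (F.P K) 0, (1 / 2) * (((((GaugeField.plaqHol W p : Matrix.specialUnitaryGroup (Fin 2) ℂ) : Matrix (Fin 2) (Fin 2) ℂ) - 1)ᴴ * (((Complex.I • D ⟨p.src, p.μ⟩) + ((W ⟨p.src, p.μ⟩ : Matrix (Fin 2) (Fin 2) ℂ) * (Complex.I • D ⟨p.src.shift p.μ, p.ν⟩) * star (W ⟨p.src, p.μ⟩ : Matrix (Fin 2) (Fin 2) ℂ))
            - (((W ⟨p.src, p.μ⟩ * W ⟨p.src.shift p.μ, p.ν⟩ * (W ⟨p.src.shift p.ν, p.μ⟩)⁻¹ : Matrix.specialUnitaryGroup (Fin 2) ℂ) : Matrix (Fin 2) (Fin 2) ℂ) * (Complex.I • D ⟨p.src.shift p.ν, p.μ⟩) * star ((W ⟨p.src, p.μ⟩ * W ⟨p.src.shift p.μ, p.ν⟩ * (W ⟨p.src.shift p.ν, p.μ⟩)⁻¹ : Matrix.specialUnitaryGroup (Fin 2) ℂ) : Matrix (Fin 2) (Fin 2) ℂ))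
            - (((GaugeField.plaqHol W p : Matrix.specialUnitaryGroup (Fin 2) ℂ) : Matrix (Fin 2) (Fin 2) ℂ) * (Complex.I • D ⟨p.src, p.ν⟩) * star ((GaugeField.plaqHol W p : Matrix.specialUnitaryGroup (Fin 2) ℂ) : Matrix (Fin 2) (Fin 2) ℂ))) * ((GaugeField.plaqHol W p : Matrix.specialUnitaryGroup (Fin 2) ℂ) : Matrix (Fin 2) (Fin 2) ℂ))).trace).re| ≤ 2 * ε₀ * C₁ * (ℓ ^ 2)⁻¹ * M + 2 * ε₀ * C₂ * Kc := by
    have := hELQ.trans (mul_le_mul_of_nonneg_left hR hco)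
    have e1 : 2 * ε₀ * ℓ⁻¹ * (C₁ * ℓ⁻¹ * M + C₂ * ℓ * Kc) = 2 * ε₀ * C₁ * (ℓ ^ 2)⁻¹ * M + 2 * ε₀ * C₂ * Kc := by
      field_simp
    linarith [e1]
  have h2 : 2 * ε₀ * C₂ * Kc ≤ 1 / 8 * Kc := mul_le_mul_of_nonneg_right hw₁ hK0
  have h3 : (2 * ε₀ * C₁ * (ℓ ^ 2)⁻¹ + 15552 * s ^ 2 + 216 * regThreshold F n K e) * M ≤ κ / 8 * M := mul_le_mul_of_nonneg_right hw₂ hM0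
  nlinarith [h1, h2, h3, hq', hK0]

/-- ★★ **THE ACTION-LEVEL SOCKET WITH SLACK (TAYLOR ONLY).**  If the Lin-level row holds with a slack `σ` — `|ℓ_W(D)| + (15552s² + 216·regThreshold(e))·Σ‖D‖² ≤
¼·Σ_p‖ℒ_p(D)‖² + σ` — then `A(W) ≤ A(e^{iD}W) + σ` (`σ := Dv∕32` from `linRow_of_QRows_div`; `σ = 0` is ✓`wilsonAction4_le_expChart_of_linRow`).
[cite: Balaban1985Variational, (141)-(142) p.299, (116) p.295, (6) p.278] -/
theorem wilsonAction4_le_expChart_of_linRow_slack {e s σ : ℝ} {W : GaugeField (F.P K) 0 (Matrix.specialUnitaryGroup (Fin 2) ℂ)} (hreg : RegPr F n K e W)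
    (D : PBond (F.P K) 0 → Matrix (Fin 2) (Fin 2) ℂ) (hDh : ∀ b : PBond (F.P K) 0, (D b).IsHermitian ∧ Matrix.trace (D b) = 0)
    (hDs : ∀ b : PBond (F.P K) 0, ‖D b‖ ≤ s) (hs4 : 4 * s ≤ 1)
    (hlin : |∑ p : Plaq (F.P K) 0, (1 / 2) * (((((GaugeField.plaqHol W p : Matrix.specialUnitaryGroup (Fin 2) ℂ) : Matrix (Fin 2) (Fin 2) ℂ) - 1)ᴴ * (((Complex.I • D ⟨p.src, p.μ⟩) + ((W ⟨p.src, p.μ⟩ : Matrix (Fin 2) (Fin 2) ℂ) * (Complex.I • D ⟨p.src.shift p.μ, p.ν⟩) * star (W ⟨p.src, p.μ⟩ : Matrix (Fin 2) (Fin 2) ℂ))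
            - (((W ⟨p.src, p.μ⟩ * W ⟨p.src.shift p.μ, p.ν⟩ * (W ⟨p.src.shift p.ν, p.μ⟩)⁻¹ : Matrix.specialUnitaryGroup (Fin 2) ℂ) : Matrix (Fin 2) (Fin 2) ℂ) * (Complex.I • D ⟨p.src.shift p.ν, p.μ⟩) * star ((W ⟨p.src, p.μ⟩ * W ⟨p.src.shift p.μ, p.ν⟩ * (W ⟨p.src.shift p.ν, p.μ⟩)⁻¹ : Matrix.specialUnitaryGroup (Fin 2) ℂ) : Matrix (Fin 2) (Fin 2) ℂ))
            - (((GaugeField.plaqHol W p : Matrix.specialUnitaryGroup (Fin 2) ℂ) : Matrix (Fin 2) (Fin 2) ℂ) * (Complex.I • D ⟨p.src, p.ν⟩) * star ((GaugeField.plaqHol W p : Matrix.specialUnitaryGroup (Fin 2) ℂ) : Matrix (Fin 2) (Fin 2) ℂ))) * ((GaugeField.plaqHol W p : Matrix.specialUnitaryGroup (Fin 2) ℂ) : Matrix (Fin 2) (Fin 2) ℂ))).trace).re|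
        + (15552 * s ^ 2 + 216 * regThreshold F n K e) * ∑ b : PBond (F.P K) 0, ‖D b‖ ^ 2
      ≤ 1 / 4 * ∑ p : Plaq (F.P K) 0, ‖((Complex.I • D ⟨p.src, p.μ⟩) + ((W ⟨p.src, p.μ⟩ : Matrix (Fin 2) (Fin 2) ℂ) * (Complex.I • D ⟨p.src.shift p.μ, p.ν⟩) * star (W ⟨p.src, p.μ⟩ : Matrix (Fin 2) (Fin 2) ℂ))
            - (((W ⟨p.src, p.μ⟩ * W ⟨p.src.shift p.μ, p.ν⟩ * (W ⟨p.src.shift p.ν, p.μ⟩)⁻¹ : Matrix.specialUnitaryGroup (Fin 2) ℂ) : Matrix (Fin 2) (Fin 2) ℂ) * (Complex.I • D ⟨p.src.shift p.ν, p.μ⟩) * star ((W ⟨p.src, p.μ⟩ * W ⟨p.src.shift p.μ, p.ν⟩ * (W ⟨p.src.shift p.ν, p.μ⟩)⁻¹ : Matrix.specialUnitaryGroup (Fin 2) ℂ) : Matrix (Fin 2) (Fin 2) ℂ))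
            - (((GaugeField.plaqHol W p : Matrix.specialUnitaryGroup (Fin 2) ℂ) : Matrix (Fin 2) (Fin 2) ℂ) * (Complex.I • D ⟨p.src, p.ν⟩) * star ((GaugeField.plaqHol W p : Matrix.specialUnitaryGroup (Fin 2) ℂ) : Matrix (Fin 2) (Fin 2) ℂ)))‖ ^ 2 + σ) :
    wilsonAction4 W ≤ wilsonAction4 (emb15 W (expHermField D)) + σ := by
  have he0 : 0 < e := pos_of_regPr F hreg
  have hthr0 : 0 ≤ regThreshold F n K e := by unfold regThreshold; positivity
  have ha : ∀ p : Plaq (F.P K) 0, ‖((GaugeField.plaqHol W p : Matrix.specialUnitaryGroup (Fin 2) ℂ) : Matrix (Fin 2) (Fin 2) ℂ) - 1‖ ≤ regThreshold F n K e := fun p => by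
    have hp := hreg.1 p
    rw [SU2Mean.dist1_eq_norm] at hp
    exact hp.le
  have hT := wilsonAction4_expChart_sub_lin_ge W D hDh hDs hs4 hthr0 ha (θ := 1 / 2) (by norm_num) (by norm_num)
  rw [show ((1 : ℝ) - 1 / 2) / 2 = 1 / 4 by norm_num, show (7776 : ℝ) * (1 / 2)⁻¹ = 15552 by norm_num] at hT
  have habs := neg_abs_le (∑ p : Plaq (F.P K) 0, (1 / 2) * (((((GaugeField.plaqHol W p : Matrix.specialUnitaryGroup (Fin 2) ℂ) : Matrix (Fin 2) (Fin 2) ℂ) - 1)ᴴ * (((Complex.I • D ⟨p.src, p.μ⟩) + ((W ⟨p.src, p.μ⟩ : Matrix (Fin 2) (Fin 2) ℂ) * (Complex.I • D ⟨p.src.shift p.μ, p.ν⟩) * star (W ⟨p.src, p.μ⟩ : Matrix (Fin 2) (Fin 2) ℂ))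
            - (((W ⟨p.src, p.μ⟩ * W ⟨p.src.shift p.μ, p.ν⟩ * (W ⟨p.src.shift p.ν, p.μ⟩)⁻¹ : Matrix.specialUnitaryGroup (Fin 2) ℂ) : Matrix (Fin 2) (Fin 2) ℂ) * (Complex.I • D ⟨p.src.shift p.ν, p.μ⟩) * star ((W ⟨p.src, p.μ⟩ * W ⟨p.src.shift p.μ, p.ν⟩ * (W ⟨p.src.shift p.ν, p.μ⟩)⁻¹ : Matrix.specialUnitaryGroup (Fin 2) ℂ) : Matrix (Fin 2) (Fin 2) ℂ))
            - (((GaugeField.plaqHol W p : Matrix.specialUnitaryGroup (Fin 2) ℂ) : Matrix (Fin 2) (Fin 2) ℂ) * (Complex.I • D ⟨p.src, p.ν⟩) * star ((GaugeField.plaqHol W p : Matrix.specialUnitaryGroup (Fin 2) ℂ) : Matrix (Fin 2) (Fin 2) ℂ))) * ((GaugeField.plaqHol W p : Matrix.specialUnitaryGroup (Fin 2) ℂ) : Matrix (Fin 2) (Fin 2) ℂ))).trace).re)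
  linarith [hT, habs, hlin]

/-! ## §5b The (σ, Z)-budget twin: (H1) ✓`Prop7HessWOfFibreCoreT3.hessW_budget_of_fibre_T3`'s conclusion shape VERBATIM (★p1-19200 g13 2026-08-28 13:39Z (o1)) -/

/-- ★★ **THE Lin-LEVEL ROW FROM THE (σ, Z) DIVERGENCE-BUDGET FORM OF HESS_W′.**  Hypothesis `hH1` is the conclusion of ✓`hessW_budget_of_fibre_T3` verbatim
(`A′ = 18 + 537600L⁴`, `σ = 2δ + 321072s² + 1536(eℓ⁻²)²`, divergence budget `(δ, Z)`); with `|ℓ_W(D)| ≤ 2ε₀ℓ⁻¹R`, the JOINT remainder row and the window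
`2ε₀C₂ ≤ ⅛`, `64A′·(2ε₀C₁ℓ⁻² + 15552s² + 216·regThreshold(e)) ≤ ⅛ℓ⁻² − A′σ`, the Lin-level row holds with slack `Z∕32`. Pure bookkeeping.
[cite: Balaban1985Variational, (116) p.295, (141)-(143) p.299] -/
theorem linRow_of_QRows_budget {e s ε₀ R C₁ C₂ δ Z : ℝ} (hε₀ : 0 ≤ ε₀) (W : GaugeField (F.P K) 0 (Matrix.specialUnitaryGroup (Fin 2) ℂ)) (D : PBond (F.P K) 0 → Matrix (Fin 2) (Fin 2) ℂ)
    (hELQ : |∑ p : Plaq (F.P K) 0, (1 / 2) * (((((GaugeField.plaqHol W p : Matrix.specialUnitaryGroup (Fin 2) ℂ) : Matrix (Fin 2) (Fin 2) ℂ) - 1)ᴴ * (((Complex.I • D ⟨p.src, p.μ⟩) + ((W ⟨p.src, p.μ⟩ : Matrix (Fin 2) (Fin 2) ℂ) * (Complex.I • D ⟨p.src.shift p.μ, p.ν⟩) * star (W ⟨p.src, p.μ⟩ : Matrix (Fin 2) (Fin 2) ℂ))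
            - (((W ⟨p.src, p.μ⟩ * W ⟨p.src.shift p.μ, p.ν⟩ * (W ⟨p.src.shift p.ν, p.μ⟩)⁻¹ : Matrix.specialUnitaryGroup (Fin 2) ℂ) : Matrix (Fin 2) (Fin 2) ℂ) * (Complex.I • D ⟨p.src.shift p.ν, p.μ⟩) * star ((W ⟨p.src, p.μ⟩ * W ⟨p.src.shift p.μ, p.ν⟩ * (W ⟨p.src.shift p.ν, p.μ⟩)⁻¹ : Matrix.specialUnitaryGroup (Fin 2) ℂ) : Matrix (Fin 2) (Fin 2) ℂ))
            - (((GaugeField.plaqHol W p : Matrix.specialUnitaryGroup (Fin 2) ℂ) : Matrix (Fin 2) (Fin 2) ℂ) * (Complex.I • D ⟨p.src, p.ν⟩) * star ((GaugeField.plaqHol W p : Matrix.specialUnitaryGroup (Fin 2) ℂ) : Matrix (Fin 2) (Fin 2) ℂ))) * ((GaugeField.plaqHol W p : Matrix.specialUnitaryGroup (Fin 2) ℂ) : Matrix (Fin 2) (Fin 2) ℂ))).trace).re| ≤ 2 * ε₀ * ((F.L : ℝ) ^ (K - n))⁻¹ * R)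
    (hR : R ≤ C₁ * ((F.L : ℝ) ^ (K - n))⁻¹ * ∑ b : PBond (F.P K) 0, ‖D b‖ ^ 2 + C₂ * (F.L : ℝ) ^ (K - n) * ∑ p : Plaq (F.P K) 0, ‖((Complex.I • D ⟨p.src, p.μ⟩) + ((W ⟨p.src, p.μ⟩ : Matrix (Fin 2) (Fin 2) ℂ) * (Complex.I • D ⟨p.src.shift p.μ, p.ν⟩) * star (W ⟨p.src, p.μ⟩ : Matrix (Fin 2) (Fin 2) ℂ))
            - (((W ⟨p.src, p.μ⟩ * W ⟨p.src.shift p.μ, p.ν⟩ * (W ⟨p.src.shift p.ν, p.μ⟩)⁻¹ : Matrix.specialUnitaryGroup (Fin 2) ℂ) : Matrix (Fin 2) (Fin 2) ℂ) * (Complex.I • D ⟨p.src.shift p.ν, p.μ⟩) * star ((W ⟨p.src, p.μ⟩ * W ⟨p.src.shift p.μ, p.ν⟩ * (W ⟨p.src.shift p.ν, p.μ⟩)⁻¹ : Matrix.specialUnitaryGroup (Fin 2) ℂ) : Matrix (Fin 2) (Fin 2) ℂ))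
            - (((GaugeField.plaqHol W p : Matrix.specialUnitaryGroup (Fin 2) ℂ) : Matrix (Fin 2) (Fin 2) ℂ) * (Complex.I • D ⟨p.src, p.ν⟩) * star ((GaugeField.plaqHol W p : Matrix.specialUnitaryGroup (Fin 2) ℂ) : Matrix (Fin 2) (Fin 2) ℂ)))‖ ^ 2)
    (hH1 : ((1 / 8) * ((((F.L : ℝ) ^ (K - n))) ^ 2)⁻¹
        - (18 + 537600 * (F.L : ℝ) ^ 4) * (2 * δ + 321072 * s ^ 2 + 1536 * (e * ((((F.L : ℝ) ^ (K - n))) ^ 2)⁻¹) ^ 2)) * (∑ b : PBond (F.P K) 0, ‖D b‖ ^ 2)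
      - 2 * (18 + 537600 * (F.L : ℝ) ^ 4) * Z
      ≤ 8 * (18 + 537600 * (F.L : ℝ) ^ 4) * ∑ p : Plaq (F.P K) 0, ‖((Complex.I • D ⟨p.src, p.μ⟩) + ((W ⟨p.src, p.μ⟩ : Matrix (Fin 2) (Fin 2) ℂ) * (Complex.I • D ⟨p.src.shift p.μ, p.ν⟩) * star (W ⟨p.src, p.μ⟩ : Matrix (Fin 2) (Fin 2) ℂ))
            - (((W ⟨p.src, p.μ⟩ * W ⟨p.src.shift p.μ, p.ν⟩ * (W ⟨p.src.shift p.ν, p.μ⟩)⁻¹ : Matrix.specialUnitaryGroup (Fin 2) ℂ) : Matrix (Fin 2) (Fin 2) ℂ) * (Complex.I • D ⟨p.src.shift p.ν, p.μ⟩) * star ((W ⟨p.src, p.μ⟩ * W ⟨p.src.shift p.μ, p.ν⟩ * (W ⟨p.src.shift p.ν, p.μ⟩)⁻¹ : Matrix.specialUnitaryGroup (Fin 2) ℂ) : Matrix (Fin 2) (Fin 2) ℂ))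
            - (((GaugeField.plaqHol W p : Matrix.specialUnitaryGroup (Fin 2) ℂ) : Matrix (Fin 2) (Fin 2) ℂ) * (Complex.I • D ⟨p.src, p.ν⟩) * star ((GaugeField.plaqHol W p : Matrix.specialUnitaryGroup (Fin 2) ℂ) : Matrix (Fin 2) (Fin 2) ℂ)))‖ ^ 2)
    (hw₁ : 2 * ε₀ * C₂ ≤ 1 / 8)
    (hw₂ : 64 * (18 + 537600 * (F.L : ℝ) ^ 4) * (2 * ε₀ * C₁ * (((F.L : ℝ) ^ (K - n)) ^ 2)⁻¹ + 15552 * s ^ 2 + 216 * regThreshold F n K e)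
      ≤ (1 / 8) * ((((F.L : ℝ) ^ (K - n))) ^ 2)⁻¹
        - (18 + 537600 * (F.L : ℝ) ^ 4) * (2 * δ + 321072 * s ^ 2 + 1536 * (e * ((((F.L : ℝ) ^ (K - n))) ^ 2)⁻¹) ^ 2)) :
    |∑ p : Plaq (F.P K) 0, (1 / 2) * (((((GaugeField.plaqHol W p : Matrix.specialUnitaryGroup (Fin 2) ℂ) : Matrix (Fin 2) (Fin 2) ℂ) - 1)ᴴ * (((Complex.I • D ⟨p.src, p.μ⟩) + ((W ⟨p.src, p.μ⟩ : Matrix (Fin 2) (Fin 2) ℂ) * (Complex.I • D ⟨p.src.shift p.μ, p.ν⟩) * star (W ⟨p.src, p.μ⟩ : Matrix (Fin 2) (Fin 2) ℂ))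
            - (((W ⟨p.src, p.μ⟩ * W ⟨p.src.shift p.μ, p.ν⟩ * (W ⟨p.src.shift p.ν, p.μ⟩)⁻¹ : Matrix.specialUnitaryGroup (Fin 2) ℂ) : Matrix (Fin 2) (Fin 2) ℂ) * (Complex.I • D ⟨p.src.shift p.ν, p.μ⟩) * star ((W ⟨p.src, p.μ⟩ * W ⟨p.src.shift p.μ, p.ν⟩ * (W ⟨p.src.shift p.ν, p.μ⟩)⁻¹ : Matrix.specialUnitaryGroup (Fin 2) ℂ) : Matrix (Fin 2) (Fin 2) ℂ))
            - (((GaugeField.plaqHol W p : Matrix.specialUnitaryGroup (Fin 2) ℂ) : Matrix (Fin 2) (Fin 2) ℂ) * (Complex.I • D ⟨p.src, p.ν⟩) * star ((GaugeField.plaqHol W p : Matrix.specialUnitaryGroup (Fin 2) ℂ) : Matrix (Fin 2) (Fin 2) ℂ))) * ((GaugeField.plaqHol W p : Matrix.specialUnitaryGroup (Fin 2) ℂ) : Matrix (Fin 2) (Fin 2) ℂ))).trace).re|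
        + (15552 * s ^ 2 + 216 * regThreshold F n K e) * ∑ b : PBond (F.P K) 0, ‖D b‖ ^ 2
      ≤ 1 / 4 * ∑ p : Plaq (F.P K) 0, ‖((Complex.I • D ⟨p.src, p.μ⟩) + ((W ⟨p.src, p.μ⟩ : Matrix (Fin 2) (Fin 2) ℂ) * (Complex.I • D ⟨p.src.shift p.μ, p.ν⟩) * star (W ⟨p.src, p.μ⟩ : Matrix (Fin 2) (Fin 2) ℂ))
            - (((W ⟨p.src, p.μ⟩ * W ⟨p.src.shift p.μ, p.ν⟩ * (W ⟨p.src.shift p.ν, p.μ⟩)⁻¹ : Matrix.specialUnitaryGroup (Fin 2) ℂ) : Matrix (Fin 2) (Fin 2) ℂ) * (Complex.I • D ⟨p.src.shift p.ν, p.μ⟩) * star ((W ⟨p.src, p.μ⟩ * W ⟨p.src.shift p.μ, p.ν⟩ * (W ⟨p.src.shift p.ν, p.μ⟩)⁻¹ : Matrix.specialUnitaryGroup (Fin 2) ℂ) : Matrix (Fin 2) (Fin 2) ℂ))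
            - (((GaugeField.plaqHol W p : Matrix.specialUnitaryGroup (Fin 2) ℂ) : Matrix (Fin 2) (Fin 2) ℂ) * (Complex.I • D ⟨p.src, p.ν⟩) * star ((GaugeField.plaqHol W p : Matrix.specialUnitaryGroup (Fin 2) ℂ) : Matrix (Fin 2) (Fin 2) ℂ)))‖ ^ 2 + 1 / 32 * Z := by
  have hL1 : (1 : ℝ) ≤ (F.L : ℝ) := by have := F.hL.2; exact_mod_cast (by omega : 1 ≤ F.L)
  set ℓ : ℝ := (F.L : ℝ) ^ (K - n) with hℓ
  have hℓ1 : 1 ≤ ℓ := one_le_pow₀ hL1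
  have hℓ0 : 0 < ℓ := by linarith
  set M : ℝ := ∑ b : PBond (F.P K) 0, ‖D b‖ ^ 2 with hM
  set Kc : ℝ := ∑ p : Plaq (F.P K) 0, ‖((Complex.I • D ⟨p.src, p.μ⟩) + ((W ⟨p.src, p.μ⟩ : Matrix (Fin 2) (Fin 2) ℂ) * (Complex.I • D ⟨p.src.shift p.μ, p.ν⟩) * star (W ⟨p.src, p.μ⟩ : Matrix (Fin 2) (Fin 2) ℂ))
            - (((W ⟨p.src, p.μ⟩ * W ⟨p.src.shift p.μ, p.ν⟩ * (W ⟨p.src.shift p.ν, p.μ⟩)⁻¹ : Matrix.specialUnitaryGroup (Fin 2) ℂ) : Matrix (Fin 2) (Fin 2) ℂ) * (Complex.I • D ⟨p.src.shift p.ν, p.μ⟩) * star ((W ⟨p.src, p.μ⟩ * W ⟨p.src.shift p.μ, p.ν⟩ * (W ⟨p.src.shift p.ν, p.μ⟩)⁻¹ : Matrix.specialUnitaryGroup (Fin 2) ℂ) : Matrix (Fin 2) (Fin 2) ℂ))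
            - (((GaugeField.plaqHol W p : Matrix.specialUnitaryGroup (Fin 2) ℂ) : Matrix (Fin 2) (Fin 2) ℂ) * (Complex.I • D ⟨p.src, p.ν⟩) * star ((GaugeField.plaqHol W p : Matrix.specialUnitaryGroup (Fin 2) ℂ) : Matrix (Fin 2) (Fin 2) ℂ)))‖ ^ 2 with hKc
  set A' : ℝ := 18 + 537600 * (F.L : ℝ) ^ 4 with hA'
  have hA'0 : 0 < A' := by positivity
  have hM0 : 0 ≤ M := Finset.sum_nonneg fun _ _ => sq_nonneg _
  have hK0 : 0 ≤ Kc := Finset.sum_nonneg fun _ _ => sq_nonneg _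
  have hco : 0 ≤ 2 * ε₀ * ℓ⁻¹ := by positivity
  have h1 : |∑ p : Plaq (F.P K) 0, (1 / 2) * (((((GaugeField.plaqHol W p : Matrix.specialUnitaryGroup (Fin 2) ℂ) : Matrix (Fin 2) (Fin 2) ℂ) - 1)ᴴ * (((Complex.I • D ⟨p.src, p.μ⟩) + ((W ⟨p.src, p.μ⟩ : Matrix (Fin 2) (Fin 2) ℂ) * (Complex.I • D ⟨p.src.shift p.μ, p.ν⟩) * star (W ⟨p.src, p.μ⟩ : Matrix (Fin 2) (Fin 2) ℂ))
            - (((W ⟨p.src, p.μ⟩ * W ⟨p.src.shift p.μ, p.ν⟩ * (W ⟨p.src.shift p.ν, p.μ⟩)⁻¹ : Matrix.specialUnitaryGroup (Fin 2) ℂ) : Matrix (Fin 2) (Fin 2) ℂ) * (Complex.I • D ⟨p.src.shift p.ν, p.μ⟩) * star ((W ⟨p.src, p.μ⟩ * W ⟨p.src.shift p.μ, p.ν⟩ * (W ⟨p.src.shift p.ν, p.μ⟩)⁻¹ : Matrix.specialUnitaryGroup (Fin 2) ℂ) : Matrix (Fin 2) (Fin 2) ℂ))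
            - (((GaugeField.plaqHol W p : Matrix.specialUnitaryGroup (Fin 2) ℂ) : Matrix (Fin 2) (Fin 2) ℂ) * (Complex.I • D ⟨p.src, p.ν⟩) * star ((GaugeField.plaqHol W p : Matrix.specialUnitaryGroup (Fin 2) ℂ) : Matrix (Fin 2) (Fin 2) ℂ))) * ((GaugeField.plaqHol W p : Matrix.specialUnitaryGroup (Fin 2) ℂ) : Matrix (Fin 2) (Fin 2) ℂ))).trace).re| ≤ 2 * ε₀ * C₁ * (ℓ ^ 2)⁻¹ * M + 2 * ε₀ * C₂ * Kc := by
    have := hELQ.trans (mul_le_mul_of_nonneg_left hR hco)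
    have e1 : 2 * ε₀ * ℓ⁻¹ * (C₁ * ℓ⁻¹ * M + C₂ * ℓ * Kc) = 2 * ε₀ * C₁ * (ℓ ^ 2)⁻¹ * M + 2 * ε₀ * C₂ * Kc := by
      field_simp
    linarith only [e1, this]
  have h2 : 2 * ε₀ * C₂ * Kc ≤ 1 / 8 * Kc := mul_le_mul_of_nonneg_right hw₁ hK0
  have h3 : 64 * A' * (2 * ε₀ * C₁ * (ℓ ^ 2)⁻¹ + 15552 * s ^ 2 + 216 * regThreshold F n K e) * M ≤ (1 / 8 * (ℓ ^ 2)⁻¹ - A' * (2 * δ + 321072 * s ^ 2 + 1536 * (e * (ℓ ^ 2)⁻¹) ^ 2)) * M := mul_le_mul_of_nonneg_right hw₂ hM0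
  have h4 : (1 / 8 * (ℓ ^ 2)⁻¹ - A' * (2 * δ + 321072 * s ^ 2 + 1536 * (e * (ℓ ^ 2)⁻¹) ^ 2)) * M ≤ 8 * A' * Kc + 2 * A' * Z := by linarith only [hH1]
  have h5 : (2 * ε₀ * C₁ * (ℓ ^ 2)⁻¹ + 15552 * s ^ 2 + 216 * regThreshold F n K e) * M ≤ Kc / 8 + Z / 32 := by
    have key : 64 * A' * ((2 * ε₀ * C₁ * (ℓ ^ 2)⁻¹ + 15552 * s ^ 2 + 216 * regThreshold F n K e) * M) ≤ 64 * A' * (Kc / 8 + Z / 32) := by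
      have e1 : 64 * A' * ((2 * ε₀ * C₁ * (ℓ ^ 2)⁻¹ + 15552 * s ^ 2 + 216 * regThreshold F n K e) * M) = 64 * A' * (2 * ε₀ * C₁ * (ℓ ^ 2)⁻¹ + 15552 * s ^ 2 + 216 * regThreshold F n K e) * M := by ring
      rw [e1]
      linarith only [h3, h4]
    exact le_of_mul_le_mul_left key (by positivity)
  have e3 : (2 * ε₀ * C₁ * (ℓ ^ 2)⁻¹ + 15552 * s ^ 2 + 216 * regThreshold F n K e) * M = 2 * ε₀ * C₁ * (ℓ ^ 2)⁻¹ * M + (15552 * s ^ 2 + 216 * regThreshold F n K e) * M := by ring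
  linarith only [h1, h2, h5, e3]

end Summit.QuantumFields.YangMills.Theorems.Prop7LocMinOfJointRowBudget

end
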